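import Mathlib
import Summits.CriticalPhenomena.CardyFormulaZ2.Theorems.CardySelfRefinementDefs
import Summits.CriticalPhenomena.CardyFormulaZ2.Theorems.CardySelfRefinementGradientComparabilityStubCornerHWBBypassGeom
import Literature.Probability.LatticeModels.ProdBernoulliIndependence
import HarnessLib

/-!
# Crux `GradientComparability` (stmt-CriticalPhenomena-10269), line `monotone-product-coordinates` —
# stub `stub_cornerHardWayBoxes` (HWB), brick (ii-c), part 3: the cost of the bypass surgery

Route `CardySelfRefinement`; vocabulary from `CardySelfRefinementDefs` (`ax tb opn cfg dirVec`); the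
deterministic surgery `bypass_openCrossing` from `…StubCornerHWBBypassGeom`; the two-coin read-out
facts of `…StubCornerHWBRhoLeg` (`cfg_eq_of_selector_notMem`); independence of disjoint coin sets
(`prodBernoulli_real_inter_of_determinedBy`).

## Mathematics

Fix `k = 2, 3`, a bundle `b = (t, d)` with shared coin `sh`, an open crossing event `X` of a
box-closed two-neighbour region between slabs, `E = cfg k ⁻¹' X`, and ANY product coin law `q`.
If `sh` is pivotal at the coin sample `S` (`S ∪ {sh} ∈ E`, `S ∖ {sh} ∉ E`) then the selector of `b`
is on (otherwise `sh` is unread), so by `bypass_openCrossing` `(S ∖ {sh}) ∪ G ∈ E` for the set `G`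
of own coins of the `≤ 2(k+3)²` interior strip edges of `b`; adding the coins of `G` one at a time
to `S ∖ {sh} ∉ E`, some `g ∈ G` is pivotal at `(S ∖ {sh}) ∪ H`, `H ⊆ G` (`exists_pivotal_of_union_mem`).
Hence `{sh pivotal} ⊆ ⋃_{g ∈ G} ⋃_{H ⊆ G} Φ_{H}⁻¹ {g pivotal}`, `Φ_H(S) = (S ∖ {sh}) ∪ H`, and by
finite energy (`prodBernoulli_real_sdiff_le`, `prodBernoulli_real_union_le`: forcing coins costs the
inverse of their probability) `P(sh pivotal) ≤ 4 (2/c₁)^{2(k+3)²} Σ_{g ∈ G} P(g pivotal)` as soon as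
interior own coins have bias `≥ c₁` and `q(sh) ≤ 3/4` (`real_sharedPivotal_le_sum_interior`,
REGISTERED).  (Aizenman–Grimmett 1991; Grimmett 1999 §3.3.)
-/

noncomputable section

namespace Summit.CriticalPhenomena.CardyFormulaZ2.Theorems.CardySelfRefinement

open scoped Topology
open Filter Set MeasureTheory
open Literature.Probability.LatticeModels Literature.Probability.Percolation
open Literature.Probability.Percolation.QuadCrossing
open Summit.CriticalPhenomena.CardyFormulaZ2.Theses.CardySelfRefinement

/-- The strip `N` of the bundle `(t, d)` (local notation, as in `…StubCornerHWBBypassWalk`). -/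
local notation3 (prettyPrint := false) "inN(" k ", " t ", " d ", " v ")" =>
  (∀ j : Fin 2, (k : ℤ) * t j - 1 ≤ (v : Site 2) j ∧ (v : Site 2) j ≤ (k : ℤ) * t j + (if j = d then (k : ℤ) + 1 else 1))

/-! ## Measure side of brick (ii-c): a pivotal shared coin costs a pivotal interior coin nearby -/

/-- **A flip index.**  If `T₀ ∉ E` but `T₀ ∪ G ∈ E` for a finite `G`, then some `g ∈ G` is pivotal
for `E` at `T₀ ∪ H` for some `H ⊆ G` not containing... with `g ∉ T₀ ∪ H`. -/
theorem exists_pivotal_of_union_mem {α : Type*} {E : Set (Set α)} {T₀ : Set α} (G : Finset α)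
    (h0 : T₀ ∉ E) (h1 : T₀ ∪ ↑G ∈ E) :
    ∃ g ∈ G, ∃ H ∈ G.powerset, g ∉ T₀ ∪ ↑H ∧ insert g (T₀ ∪ ↑H) ∈ E ∧ T₀ ∪ ↑H ∉ E := by
  classical
  induction G using Finset.induction_on with
  | empty =>
    rw [Finset.coe_empty, Set.union_empty] at h1
    exact absurd h1 h0
  | insert a G ha ih =>
    by_cases hG : T₀ ∪ ↑G ∈ E
    · obtain ⟨g, hg, H, hH, h⟩ := ih hG
      exact ⟨g, Finset.mem_insert_of_mem hg, H, Finset.mem_powerset.2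
        ((Finset.mem_powerset.1 hH).trans (Finset.subset_insert _ _)), h⟩
    · rw [Finset.coe_insert, Set.union_insert] at h1
      refine ⟨a, Finset.mem_insert_self _ _, G, Finset.mem_powerset.2 (Finset.subset_insert _ _),
        fun haT => hG ?_, h1, hG⟩
      rwa [Set.insert_eq_of_mem haT] at h1

/-- **Finite energy, forcing finitely many coins on**: `(∏_{i ∈ H} q i) · P{S | S ∪ H ∈ A} ≤ P(A)`. -/
theorem prodBernoulli_real_union_le {ι : Type*} (q : ι → unitInterval) (H : Finset ι)
    {A : Set (Set ι)} (hA : MeasurableSet A) :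
    (∏ i ∈ H, (q i : ℝ)) * (prodBernoulli q).real {S | S ∪ ↑H ∈ A} ≤ (prodBernoulli q).real A := by
  classical
  have hBdet : DeterminedBy {S : Set ι | S ∪ ↑H ∈ A} (↑H : Set ι)ᶜ := by
    rw [determinedBy_iff]
    intro S₁ S₂ h
    simp only [Set.mem_setOf_eq]
    have e : S₁ ∪ ↑H = S₂ ∪ ↑H := by
      rw [← Set.sdiff_union_self, Set.sdiff_eq, h, ← Set.sdiff_eq, Set.sdiff_union_self]
    rw [e]
  have hCdet : DeterminedBy {S : Set ι | (↑H : Set ι) ⊆ S} (↑H : Set ι) := by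
    rw [determinedBy_iff]
    intro S₁ S₂ h
    exact ⟨fun h1 i hi => ((Set.ext_iff.1 h i).1 ⟨h1 hi, hi⟩).1,
      fun h2 i hi => ((Set.ext_iff.1 h i).2 ⟨h2 hi, hi⟩).1⟩
  have hCm : MeasurableSet {S : Set ι | (↑H : Set ι) ⊆ S} := by
    have e : {S : Set ι | (↑H : Set ι) ⊆ S} = ⋂ i ∈ H, {S | i ∈ S} := by
      ext S
      simp [Set.subset_def]
    rw [e]
    exact MeasurableSet.biInter H.countable_toSet fun i _ => (measurable_set_mem i).setOf
  have hgm : Measurable fun S : Set ι => S ∪ ↑H :=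
    measurable_set_iff.2 fun x => (measurable_set_mem x).or measurable_const
  have hBm : MeasurableSet {S : Set ι | S ∪ ↑H ∈ A} := hgm hA
  have hsub : {S : Set ι | (↑H : Set ι) ⊆ S} ∩ {S | S ∪ ↑H ∈ A} ⊆ A := by
    rintro S ⟨h1, h2⟩
    simpa [Set.union_eq_self_of_subset_right h1] using h2
  calc (∏ i ∈ H, (q i : ℝ)) * (prodBernoulli q).real {S | S ∪ ↑H ∈ A}
      = (prodBernoulli q).real ({S : Set ι | (↑H : Set ι) ⊆ S} ∩ {S | S ∪ ↑H ∈ A}) := by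
        rw [prodBernoulli_real_inter_of_determinedBy q H hCdet hBdet hCm hBm, prodBernoulli_real_subset]
    _ ≤ (prodBernoulli q).real A := measureReal_mono hsub (measure_ne_top _ _)

/-- **Finite energy, forcing one coin off**: `(1 - q i) · P{S | S ∖ {i} ∈ A} ≤ P(A)`. -/
theorem prodBernoulli_real_sdiff_le {ι : Type*} (q : ι → unitInterval) (i : ι)
    {A : Set (Set ι)} (hA : MeasurableSet A) :
    (1 - (q i : ℝ)) * (prodBernoulli q).real {S | S \ {i} ∈ A} ≤ (prodBernoulli q).real A := by
  classical
  have hBdet : DeterminedBy {S : Set ι | S \ {i} ∈ A} (↑({i} : Finset ι) : Set ι)ᶜ := by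
    rw [determinedBy_iff]
    intro S₁ S₂ h
    simp only [Set.mem_setOf_eq]
    rw [Finset.coe_singleton] at h
    rw [Set.sdiff_eq, Set.sdiff_eq, h]
  have hCdet : DeterminedBy {S : Set ι | i ∉ S} (↑({i} : Finset ι) : Set ι) := by
    rw [determinedBy_iff]
    intro S₁ S₂ h
    have hx : i ∈ (↑({i} : Finset ι) : Set ι) := by simp
    simp only [Set.mem_setOf_eq]
    exact not_congr ⟨fun h1 => ((Set.ext_iff.1 h i).1 ⟨h1, hx⟩).1, fun h2 => ((Set.ext_iff.1 h i).2 ⟨h2, hx⟩).1⟩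
  have hCm : MeasurableSet {S : Set ι | i ∉ S} := (measurable_set_mem i).setOf.compl
  have hBm : MeasurableSet {S : Set ι | S \ {i} ∈ A} := (measurable_sdiff_pt i) hA
  have hsub : {S : Set ι | i ∉ S} ∩ {S | S \ {i} ∈ A} ⊆ A := by
    rintro S ⟨h1, h2⟩
    have e : S \ {i} = S := Set.sdiff_singleton_eq_self h1
    simpa [e] using h2
  calc (1 - (q i : ℝ)) * (prodBernoulli q).real {S | S \ {i} ∈ A}
      = (prodBernoulli q).real ({S : Set ι | i ∉ S} ∩ {S | S \ {i} ∈ A}) := by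
        rw [prodBernoulli_real_inter_of_determinedBy q {i} hCdet hBdet hCm hBm, prodBernoulli_real_setOf_notMem]
    _ ≤ (prodBernoulli q).real A := measureReal_mono hsub (measure_ne_top _ _)

/-- The strip box of the bundle `(t, d)` as a `Finset` of sites (local notation). -/
local notation3 (prettyPrint := false) "NF(" k ", " t ", " d ")" =>
  (Finset.Icc (fun j : Fin 2 => (k : ℤ) * t j - 1) (fun j : Fin 2 => (k : ℤ) * t j + (if j = d then (k : ℤ) + 1 else 1)) : Finset (Site 2))

/-- The interior edges of the strip of the bundle `(t, d)` (local notation): non-axial edges with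
both endpoints in the strip box. -/
local notation3 (prettyPrint := false) "ByE(" k ", " t ", " d ")" =>
  ((NF(k, t, d) ×ˢ (Finset.univ : Finset (Fin 2))).filter
    (fun g : Site 2 × Fin 2 => ¬ ax k g ∧ g.1 + dirVec g.2 ∈ NF(k, t, d)))

/-- Membership in the strip box is the strip predicate. -/
theorem mem_NF_iff (k : ℕ) (t : Site 2) (d : Fin 2) (v : Site 2) : v ∈ NF(k, t, d) ↔ inN(k, t, d, v) := by
  rw [Finset.mem_Icc, Pi.le_def, Pi.le_def]
  exact ⟨fun h j => ⟨h.1 j, h.2 j⟩, fun h => ⟨fun j => (h j).1, fun j => (h j).2⟩⟩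

/-- The strip box has at most `(k + 3)²` sites. -/
theorem card_NF_le (k : ℕ) (t : Site 2) (d : Fin 2) : (NF(k, t, d)).card ≤ (k + 3) ^ 2 := by
  rw [Pi.card_Icc]
  calc ∏ j, (Finset.Icc ((fun j : Fin 2 => (k : ℤ) * t j - 1) j)
        ((fun j : Fin 2 => (k : ℤ) * t j + (if j = d then (k : ℤ) + 1 else 1)) j)).card
      ≤ (k + 3) ^ (Finset.univ : Finset (Fin 2)).card :=
        Finset.prod_le_pow_card _ _ _ fun j _ => ?_
    _ = (k + 3) ^ 2 := by simp
  rw [Int.card_Icc]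
  refine Int.toNat_le.2 ?_
  dsimp only
  split_ifs <;> push_cast <;> linarith

/-- The strip has at most `2 (k + 3)²` interior edges. -/
theorem card_ByE_le (k : ℕ) (t : Site 2) (d : Fin 2) : (ByE(k, t, d)).card ≤ 2 * (k + 3) ^ 2 := by
  refine (Finset.card_filter_le _ _).trans ?_
  rw [Finset.card_product, Finset.card_univ, Fintype.card_fin, mul_comm]
  exact Nat.mul_le_mul_left 2 (card_NF_le k t d)

/-- Adding coins other than selectors can only open edges. -/
theorem cfg_mono_of_selectors (k : ℕ) {T T' : Set (Site 2 × Fin 2 × Fin 3)} (hTT' : T ⊆ T')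
    (h2 : ∀ x ∈ T', x.2.2 = 2 → x ∈ T) : cfg k T ⊆ cfg k T' := by
  refine cfg_subset_cfg_of_opn k fun vd hopn => ?_
  obtain ⟨v, e⟩ := vd
  by_cases hax : ax k (v, e)
  · simp only [opn, if_pos hax] at hopn ⊢
    rcases hopn with ⟨hs, h1⟩ | ⟨hs, h0⟩
    · exact Or.inl ⟨hTT' hs, hTT' h1⟩
    · exact Or.inr ⟨fun h => hs (h2 _ h rfl), hTT' h0⟩
  · simp only [opn, if_neg hax] at hopn ⊢
    exact hTT' hopn

/-- **Per-bundle bound of brick (ii-c).**  For `k = 2, 3`, a bundle `(t, d)`, an open crossing event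
`X` of a box-closed two-neighbour region `R` between slabs, and ANY product coin law `q` whose own
coins of interior edges have bias `≥ c₁ ∈ (0, 1]` and whose shared coin of `(t, d)` has bias `≤ 3/4`:
the probability that the shared coin of `(t, d)` is pivotal for `cfg k ⁻¹' X` is at most
`4 (2/c₁)^{2(k+3)²}` times the sum, over the interior edges `g` of the strip of the bundle, of the
probability that the own coin of `g` is pivotal. -/
theorem real_sharedPivotal_le_sum_interior : ∀ k : ℕ, k = 2 ∨ k = 3 → ∀ (t : Site 2) (d : Fin 2) (R A B : Set (Site 2)) (j₁ : Fin 2), (∀ u ∈ R, ∀ w ∈ R, ∀ v : Site 2, (∀ j : Fin 2, min (u j) (w j) ≤ v j ∧ v j ≤ max (u j) (w j)) → v ∈ R) → (∀ v ∈ R, ∀ j : Fin 2, v + dirVec j ∈ R ∨ v - dirVec j ∈ R) → (∀ v ∈ A, v + dirVec j₁ ∈ A ∧ v - dirVec j₁ ∈ A) → (∀ v ∈ B, v + dirVec j₁ ∈ B ∧ v - dirVec j₁ ∈ B) → MeasurableSet (openCrossing R A B) → ∀ (q : Site 2 × Fin 2 × Fin 3 → unitInterval) (c₁ : ℝ), 0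 < c₁ → c₁ ≤ 1 → (∀ g : Site 2 × Fin 2, ¬ ax k g → c₁ ≤ (q (g.1, g.2, (0 : Fin 3)) : ℝ)) → (q (t, d, (1 : Fin 3)) : ℝ) ≤ 3 / 4 → (prodBernoulli q).real {S | insert (t, d, (1 : Fin 3)) S ∈ (cfg k) ⁻¹' openCrossing R A B ∧ S \ {(t, d, (1 : Fin 3))} ∉ (cfg k) ⁻¹' openCrossing R A B} ≤ 4 * (2 / c₁) ^ (2 * (k + 3) ^ 2) * ∑ g ∈ ((Finset.Icc (fun j : Fin 2 => (k : ℤ) * t j - 1) (fun j : Fin 2 => (k : ℤ) * t j + (if j = d then (k : ℤ) + 1 else 1)) : Finset (Site 2)) ×ˢ (Finset.univ : Finset (Fin 2))).filter (fun g : Site 2 × Fin 2 => ¬ ax k g ∧ g.1 + dirVec g.2 ∈ (Finset.Icc (fun j : Fin 2 => (k : ℤ) * t j - 1) (fun j : Fin 2 => (k : ℤ) * t j + (if j = d then (k : ℤ) + 1 else 1)) : Finset (Site 2))), (prodBernoulli q).real {S | insert (g.1, g.2, (0 : Fin 3)) S ∈ (cfg k) ⁻¹' openCrossing R A B ∧ S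 \ {(g.1, g.2, (0 : Fin 3))} ∉ (cfg k) ⁻¹' openCrossing R A B} := by
  intro k hk t d R A B j₁ hRc hR2 hA hB hXm q c₁ hc₁ hc₁1 hq0 hq1
  classical
  set E : Set (Set (Site 2 × Fin 2 × Fin 3)) := (cfg k) ⁻¹' openCrossing R A B with hE
  have hEm : MeasurableSet E := measurable_cfg k hXm
  set G : Finset (Site 2 × Fin 2) := ByE(k, t, d) with hG
  set emb : Site 2 × Fin 2 → Site 2 × Fin 2 × Fin 3 := fun g => (g.1, g.2, (0 : Fin 3)) with hemb
  have hinj : Function.Injective emb := fun g g' h => by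
    simp only [hemb, Prod.mk.injEq] at h
    exact Prod.ext h.1 h.2.1
  set Gc : Finset (Site 2 × Fin 2 × Fin 3) := G.image emb with hGc
  set Piv : Site 2 × Fin 2 × Fin 3 → Set (Set (Site 2 × Fin 2 × Fin 3)) :=
    fun i => {S | insert i S ∈ E ∧ S \ {i} ∉ E} with hPiv
  set M : ℕ := 2 * (k + 3) ^ 2 with hM
  have hGcard : G.card ≤ M := card_ByE_le k t d
  have hGccard : Gc.card ≤ M := Finset.card_image_le.trans hGcard
  have hPivm : ∀ i, MeasurableSet (Piv i) := fun i =>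
    ((measurable_insert_pt i) hEm).inter ((measurable_sdiff_pt i) hEm).compl
  -- Step 1: the covering by the surgery
  have hcover : Piv (t, d, (1 : Fin 3)) ⊆ ⋃ g ∈ Gc, ⋃ H ∈ Gc.powerset,
      {S | S \ {(t, d, (1 : Fin 3))} ∪ ↑H ∈ Piv g} := by
    rintro S ⟨hin, hout⟩
    have hsel : (t, d, (2 : Fin 3)) ∈ S := by
      by_contra hsel
      have e := cfg_eq_of_selector_notMem k t d (T := insert (t, d, (1 : Fin 3)) S)
        (T' := S \ {(t, d, (1 : Fin 3))}) (by simp [hsel]) (by simp [hsel]) (fun x hx => by simp [hx])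
      apply hout
      rw [hE, Set.mem_preimage, ← e]
      exact hin
    have hGc0 : ∀ i ∈ (↑Gc : Set (Site 2 × Fin 2 × Fin 3)), i.2.2 = 0 := by
      intro i hi
      obtain ⟨g, -, rfl⟩ := Finset.mem_image.1 (Finset.mem_coe.1 hi)
      rfl
    have hGc1 : ∀ g : Site 2 × Fin 2, ¬ ax k g → inN(k, t, d, g.1) → inN(k, t, d, g.1 + dirVec g.2) →
        (g.1, g.2, (0 : Fin 3)) ∈ (↑Gc : Set (Site 2 × Fin 2 × Fin 3)) := by
      intro g hax h1 h2
      refine Finset.mem_coe.2 (Finset.mem_image.2 ⟨g, ?_, rfl⟩)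
      rw [hG, Finset.mem_filter, Finset.mem_product, mem_NF_iff, mem_NF_iff]
      exact ⟨⟨h1, Finset.mem_univ _⟩, hax, h2⟩
    have hbyp := bypass_openCrossing k hk t d S ↑Gc hsel hGc0 hGc1 R A B j₁ hRc hR2 hA hB hin
    obtain ⟨g, hg, H, hH, hgH, h1, h2⟩ := exists_pivotal_of_union_mem Gc hout hbyp
    refine Set.mem_biUnion hg (Set.mem_biUnion hH ⟨h1, ?_⟩)
    have e : (S \ {(t, d, (1 : Fin 3))} ∪ ↑H) \ {g} = S \ {(t, d, (1 : Fin 3))} ∪ ↑H := by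
      simp [hgH]
    rw [e]
    exact h2
  -- Step 2: each piece costs a bounded factor
  have hq1' : (1 : ℝ) / 4 ≤ 1 - (q (t, d, (1 : Fin 3)) : ℝ) := by linarith
  have hpiece : ∀ g ∈ Gc, ∀ H ∈ Gc.powerset,
      (prodBernoulli q).real {S | S \ {(t, d, (1 : Fin 3))} ∪ ↑H ∈ Piv g} ≤
        4 * (1 / c₁) ^ M * (prodBernoulli q).real (Piv g) := by
    intro g hg H hH
    have hHG : H ⊆ Gc := Finset.mem_powerset.1 hH
    have hAm : MeasurableSet {T : Set (Site 2 × Fin 2 × Fin 3) | T ∪ ↑H ∈ Piv g} :=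
      (measurable_set_iff.2 fun x => (measurable_set_mem x).or measurable_const) (hPivm g)
    have hprod : c₁ ^ M ≤ ∏ i ∈ H, (q i : ℝ) := by
      have hHc : ∀ i ∈ H, c₁ ≤ (q i : ℝ) := by
        intro i hi
        obtain ⟨g', hg', rfl⟩ := Finset.mem_image.1 (hHG hi)
        exact hq0 g' (Finset.mem_filter.1 hg').2.1
      calc c₁ ^ M ≤ c₁ ^ H.card := pow_le_pow_of_le_one hc₁.le hc₁1 ((Finset.card_le_card hHG).trans hGccard)
        _ = ∏ _i ∈ H, c₁ := by rw [Finset.prod_const]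
        _ ≤ ∏ i ∈ H, (q i : ℝ) := Finset.prod_le_prod (fun _ _ => hc₁.le) hHc
    have hcM : 0 < c₁ ^ M := pow_pos hc₁ M
    set P1 := (prodBernoulli q).real {S | S \ {(t, d, (1 : Fin 3))} ∪ ↑H ∈ Piv g}
    set P2 := (prodBernoulli q).real {T : Set (Site 2 × Fin 2 × Fin 3) | T ∪ ↑H ∈ Piv g}
    set P3 := (prodBernoulli q).real (Piv g)
    have hP1 : 0 ≤ P1 := measureReal_nonneg
    have hP2 : 0 ≤ P2 := measureReal_nonneg
    have h1 : (1 - (q (t, d, (1 : Fin 3)) : ℝ)) * P1 ≤ P2 :=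
      prodBernoulli_real_sdiff_le q (t, d, (1 : Fin 3)) hAm
    have h2 : (∏ i ∈ H, (q i : ℝ)) * P2 ≤ P3 := prodBernoulli_real_union_le q H (hPivm g)
    have h1' : P1 ≤ 4 * P2 := by
      have := mul_le_mul_of_nonneg_right hq1' hP1
      linarith
    have h2' : c₁ ^ M * P2 ≤ P3 := le_trans (mul_le_mul_of_nonneg_right hprod hP2) h2
    have h2'' : P2 ≤ (1 / c₁) ^ M * P3 := by
      rw [one_div, inv_pow, le_inv_mul_iff₀ hcM]
      exact h2'
    calc P1 ≤ 4 * P2 := h1'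
      _ ≤ 4 * ((1 / c₁) ^ M * P3) := by linarith
      _ = 4 * (1 / c₁) ^ M * P3 := by ring
  -- Step 3: sum up
  have hpow : (2 : ℝ) ^ Gc.card ≤ 2 ^ M := pow_le_pow_right₀ (by norm_num) hGccard
  calc (prodBernoulli q).real (Piv (t, d, (1 : Fin 3)))
      ≤ (prodBernoulli q).real (⋃ g ∈ Gc, ⋃ H ∈ Gc.powerset,
          {S | S \ {(t, d, (1 : Fin 3))} ∪ ↑H ∈ Piv g}) := measureReal_mono hcover (measure_ne_top _ _)
    _ ≤ ∑ g ∈ Gc, (prodBernoulli q).real (⋃ H ∈ Gc.powerset,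
          {S | S \ {(t, d, (1 : Fin 3))} ∪ ↑H ∈ Piv g}) := measureReal_biUnion_finset_le _ _
    _ ≤ ∑ g ∈ Gc, ∑ H ∈ Gc.powerset,
          (prodBernoulli q).real {S | S \ {(t, d, (1 : Fin 3))} ∪ ↑H ∈ Piv g} :=
        Finset.sum_le_sum fun g _ => measureReal_biUnion_finset_le _ _
    _ ≤ ∑ g ∈ Gc, ∑ _H ∈ Gc.powerset, 4 * (1 / c₁) ^ M * (prodBernoulli q).real (Piv g) :=
        Finset.sum_le_sum fun g hg => Finset.sum_le_sum fun H hH => hpiece g hg H hH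
    _ = ∑ g ∈ Gc, (2 : ℝ) ^ Gc.card * (4 * (1 / c₁) ^ M * (prodBernoulli q).real (Piv g)) := by
        refine Finset.sum_congr rfl fun g _ => ?_
        rw [Finset.sum_const, Finset.card_powerset, nsmul_eq_mul]
        push_cast
        ring
    _ ≤ ∑ g ∈ Gc, (2 : ℝ) ^ M * (4 * (1 / c₁) ^ M * (prodBernoulli q).real (Piv g)) :=
        Finset.sum_le_sum fun g _ => mul_le_mul_of_nonneg_right hpow
          (by positivity)
    _ = 4 * (2 / c₁) ^ M * ∑ g ∈ Gc, (prodBernoulli q).real (Piv g) := by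
        rw [Finset.mul_sum]
        refine Finset.sum_congr rfl fun g _ => ?_
        rw [div_eq_mul_one_div (2 : ℝ) c₁, mul_pow]
        ring
    _ = 4 * (2 / c₁) ^ M * ∑ g ∈ G, (prodBernoulli q).real (Piv (emb g)) := by
        rw [hGc, Finset.sum_image fun g _ g' _ h => hinj h]

end Summit.CriticalPhenomena.CardyFormulaZ2.Theorems.CardySelfRefinement

end
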